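import Summits.BirchSwinnertonDyer.BirchSwinnertonDyer.Theorems.GenusKolyvaginAtTwoGenusPrimitiveSupplyAtTwoOfExistsKernel
import HarnessLib

/-!
# Route `GenusKolyvaginAtTwo`, crux `GenusPrimitiveSupplyAtTwo` (stmt-BirchSwinnertonDyer-22136):
# the composition and the ∃K closer UNIFORM IN A HABITAT-SIDE RESTRICTION `HW(W)` (repair rows V2 / V14a made turnkey)

Width seat bsd-line-gk2-p4 (g6), cell `bsd-f1-sign2`. CONDITIONAL; nothing is closed; BSD is not proved by any of this.

WHY. Two rows of the line's repair census restrict the HABITAT (a condition on `W` alone, not on the Heegner field):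
* V2 (lead, REPAIR CENSUS §1): `W.Δ < 0` (if crux 22137 is restated along Gross primes / the Δ>0 exactness residual Q4 bites);
* V14a (this seat, `Cruxes/GenusPrimitiveSupplyAtTwo/Lines/genus-supply-twin-selmer-rank.md`): `Nat.card (W.selmerGroup 2) ≤ 4`, i.e.
  `dim_𝔽₂ Sel₂(E) ≤ 2` — the crux asks ONE admissible `K` for both a certificate (BSD-side ⟹ `DEF(E,K) = 1`) and a `2`-Selmer-minimal twin
  `E^{(d_K)}`, and Mazur–Rubin's local calculus moves `dim Sel₂` by exactly `±1` under a `DEF = 1` twist when `2 ∣ N`, so habitat curves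
  with `dim Ш(E)[2] ≥ 4` can never comply; the clause costs 0 of the 591 row-1 habitat cells (all have `#Sel₂(E) = 4`).
Restricting the habitat changes THREE texts in lock-step — the crux's hypotheses, the negated habitat clause of the residual
`OffHabitatResidualAtTwo`, and the `by_cases` of the deciding theorem `closes` — and nothing else. This file proves that composition ONCE for
an arbitrary predicate `HW : WeierstrassCurve ℚ → Prop`:
* `nonCMAtTwo_of_restrictedHabitat HW` : (22136 with `HW W` added to the habitat) → `KolyvaginExactAtTwo` → (22139 with `HW W` added to
  the negated habitat conjunct) → `MinimalTwinBSDTwo` → PRINT {`EntireLFunctionRat`, `GrossZagierAllLevels`, `MultPublishedInputsAtTwo`,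
  `MilneAnyModel`} → leaf `Rank1Residual.NonCMAtTwo` (the CLOSED item `ExactDescentAtTwoOfFourFacts` is used by name) — the pen's new
  `closes` after a habitat edit is `exact` this theorem at its `HW`;
* `restrictedHabitatSupply_of_grossZagier_of_existsRestrictedKernel HW C` : Gross–Zagier ∧ (U∃ restricted to `HW`-habitat curves and
  `C`-fields) ⟹ the `HW`-restricted crux (V13 ∘ V14a: the ∃K kernel with both restrictions displayed);
* `nonCMAtTwo_of_restrictedHabitat_top` : with `HW := ⊤` the first theorem consumes the route's items AS TYPED (sanity check that the
  uniform statement specialises to rev 11's `closes` shape).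
Helper (`--supports stmt-BirchSwinnertonDyer-22136`). No item is closed; BSD is not proved by any of this.
-/

set_option linter.dupNamespace false -- tree convention: `Summit.BirchSwinnertonDyer.BirchSwinnertonDyer.Theorems` (summit = sub-problem)

noncomputable section

open scoped Classical

namespace Summit.BirchSwinnertonDyer.BirchSwinnertonDyer.Theorems.GenusKoly

open Finset NumberField WeierstrassCurve Literature.NumberTheory.EllipticCurves
  Literature.NumberTheory.EllipticCurves.ModularForms
open Summit.BirchSwinnertonDyer.BirchSwinnertonDyer.Theses.GenusKolyvaginAtTwo

/-! ### §1 The deciding composition, uniform in a habitat restriction `HW` -/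

/-- **The route's deciding composition with the habitat restricted by an arbitrary `HW : WeierstrassCurve ℚ → Prop`.** Hypotheses: the
crux `GenusPrimitiveSupplyAtTwo` with `HW W` inserted among the habitat clauses (`hP`), `KolyvaginExactAtTwo` (`hX`), the residual
`OffHabitatResidualAtTwo` with `HW W` inserted in the negated habitat conjunct (`hR`), `MinimalTwinBSDTwo` (`hTw`) and the four print items
of `closes`; conclusion: the leaf. Proof = `closes` (rev 11) with the `by_cases` taken on the restricted habitat; the closed item
`ExactDescentAtTwoOfFourFacts` (`GenusExactDescent.exactDescentAtTwoOfFourFacts_proof`) supplies crux #4. `HW := fun W ↦ W.Δ < 0` is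
census row V2, `HW := fun W ↦ Nat.card (W.selmerGroup 2) ≤ 4` is row V14a, their conjunction is both. CONDITIONAL on the displayed
hypotheses. [folklore] -/
theorem nonCMAtTwo_of_restrictedHabitat (HW : WeierstrassCurve ℚ → Prop)
    (hP : ∀ (W : WeierstrassCurve ℚ) [W.IsElliptic] [W.IsGloballyMinimal] [NeZero (W.conductorNorm ℤ)],
      ¬ W.HasCM → W.analyticRank = 0 → (∀ n : ℕ, 0 < n → W.HasSurjectiveModNGaloisRep ((2 : ℤ) ^ n)) →
      Odd W.tamagawaProduct → HW W →
      (∃ Dt : ModularParametrizationData W (W.conductorNorm ℤ),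
        (∀ z ∈ Dt.L.lattice, ∃ w ∈ periodLattice Dt.f, z = (Dt.c : ℂ) * w) ∧ Odd Dt.c) →
      ∃ (K : Type) (_ : Field K) (_ : NumberField K),
        IsImaginaryQuadratic K ∧ Odd (NumberField.discr K) ∧ NumberField.discr K ≠ -3 ∧
        SatisfiesHeegnerHypothesis (W.conductorNorm ℤ) K ∧
        ¬ IsSquare ((NumberField.discr K : ℚ) * -|W.Δ|) ∧ ¬ IsSquare ((NumberField.discr K : ℚ) * (-(2 * |W.Δ|))) ∧
        ∃ (Dt : ModularParametrizationData W (W.conductorNorm ℤ)) (β : ℤ) (ι : K →+* ℂ) (d₁ : KolyvaginHeegnerData Dt β ι 1),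
          (∀ z ∈ Dt.L.lattice, ∃ w ∈ periodLattice Dt.f, z = (Dt.c : ℂ) * w) ∧ Odd Dt.c ∧ ¬ IsOfFinAddOrder d₁.derivedPoint ∧
          ∃ M₀ : ℕ, (∃ Q : (W.baseChange (ringClassField K ι 1)).toAffine.Point, ((2 ^ M₀ : ℕ) : ℤ) • Q = d₁.derivedPoint) ∧
            (¬ ∃ Q : (W.baseChange (ringClassField K ι 1)).toAffine.Point, ((2 ^ (M₀ + 1) : ℕ) : ℤ) • Q = d₁.derivedPoint) ∧
            ∃ (n : ℕ) (d : KolyvaginHeegnerData Dt β ι n), Squarefree n ∧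
              (∀ ℓ ∈ n.primeFactors, Zhang2014.IsKolyvaginPrime (W.conductorNorm ℤ) W K 2 ℓ) ∧
              (¬ ∃ Q : (W.baseChange (ringClassField K ι n)).toAffine.Point, (2 : ℤ) • Q = d.derivedPoint) ∧
              ∃ (Wd : WeierstrassCurve ℚ) (_ : Wd.IsElliptic) (_ : Wd.IsGloballyMinimal),
                (∃ C : WeierstrassCurve.VariableChange ℚ, C • W.quadraticTwist (NumberField.discr K : ℚ) = Wd) ∧
                ¬ Wd.HasCM ∧ Wd.analyticRank = 1 ∧ Nat.card (Wd.selmerGroup 2) = 2)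
    (hX : KolyvaginExactAtTwo)
    (hR : ∀ (W : WeierstrassCurve ℚ) [W.IsElliptic] [W.IsGloballyMinimal] [NeZero (W.conductorNorm ℤ)],
      ¬ W.HasCM → W.analyticRank ≤ 1 →
      ¬ (W.analyticRank = 0 ∧ (∀ n : ℕ, 0 < n → W.HasSurjectiveModNGaloisRep ((2 : ℤ) ^ n)) ∧ Odd W.tamagawaProduct ∧ HW W ∧
        ∃ Dt : ModularParametrizationData W (W.conductorNorm ℤ),
          (∀ z ∈ Dt.L.lattice, ∃ w ∈ periodLattice Dt.f, z = (Dt.c : ℂ) * w) ∧ Odd Dt.c) →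
      BSDp W 2)
    (hTw : MinimalTwinBSDTwo) (hL : EntireLFunctionRat) (hGZ : GrossZagierAllLevels) (hGZK : MultPublishedInputsAtTwo)
    (hMi : MilneAnyModel) :
    Summit.BirchSwinnertonDyer.BirchSwinnertonDyer.Rank1Residual.NonCMAtTwo := by
  have hG : ExactDescentAtTwo := GenusExactDescent.exactDescentAtTwoOfFourFacts_proof ⟨hGZ, hGZK, hL, hMi⟩
  intro W _ _ hcm hr
  haveI : NeZero (W.conductorNorm ℤ) := ⟨(W.conductorNorm_pos_holds).ne'⟩
  by_cases hH : (W.analyticRank = 0 ∧ (∀ n : ℕ, 0 < n → W.HasSurjectiveModNGaloisRep ((2 : ℤ) ^ n)) ∧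
        Odd W.tamagawaProduct ∧ HW W ∧
        ∃ Dt : ModularParametrizationData W (W.conductorNorm ℤ),
          (∀ z ∈ Dt.L.lattice, ∃ w ∈ periodLattice Dt.f, z = (Dt.c : ℂ) * w) ∧ Odd Dt.c)
  · obtain ⟨hr0, hρ, hT, hHW, hopt⟩ := hH
    obtain ⟨K, _, _, hIQ, hodd, h3, hHe, hsq1, hsq2, Dt, β, ι, d₁, hoptDt, hc, hy, M₀, hdiv, hndiv,
      n, d, hn, hKoly, hPn, Wd, _, _, hWd, hcmd, hrd, hSel⟩ := hP W hcm hr0 hρ hT hHW hopt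
    have hex := hX W hcm K hIQ hodd h3 hHe hsq1 hsq2 hρ Dt β ι d₁ hy M₀ hdiv hndiv n d hn hKoly hPn
    have hBd : BSDp Wd 2 := hTw Wd hcmd hrd hSel
    exact hG W hcm hr0 hρ hT K hIQ hodd h3 hHe Dt hoptDt hc β ι d₁ hy M₀ hdiv hndiv hex Wd hWd hSel hBd
  · exact hR W hcm hr hH

/-- **Sanity check `HW := ⊤`: the uniform composition consumes the route's items AS TYPED** (`GenusPrimitiveSupplyAtTwo`,
`KolyvaginExactAtTwo`, `OffHabitatResidualAtTwo`, `MinimalTwinBSDTwo`, the four print items) — i.e. it specialises to rev 11's `closes`.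
[folklore] -/
theorem nonCMAtTwo_of_restrictedHabitat_top (hP : GenusPrimitiveSupplyAtTwo) (hX : KolyvaginExactAtTwo)
    (hR : OffHabitatResidualAtTwo) (hTw : MinimalTwinBSDTwo) (hL : EntireLFunctionRat) (hGZ : GrossZagierAllLevels)
    (hGZK : MultPublishedInputsAtTwo) (hMi : MilneAnyModel) :
    Summit.BirchSwinnertonDyer.BirchSwinnertonDyer.Rank1Residual.NonCMAtTwo := by
  refine nonCMAtTwo_of_restrictedHabitat (fun _ ↦ True) (fun W _ _ _ hcm hr0 hρ hT _ hopt ↦ hP W hcm hr0 hρ hT hopt) hX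
    (fun W _ _ _ hcm hr hH ↦ hR W hcm hr ?_) hTw hL hGZ hGZK hMi
  rintro ⟨hr0, hρ, hT, hopt⟩
  exact hH ⟨hr0, hρ, hT, trivial, hopt⟩

/-! ### §2 The ∃K closer with both restrictions displayed (`HW` on the curve, `C` on the field) -/

/-- **Gross–Zagier ∧ (U∃ restricted to `HW`-habitat curves and `C`-fields) ⟹ the `HW`-restricted crux.** The V13 closer
(`genusPrimitiveSupplyAtTwo_of_grossZagier_of_existsRestrictedKernel`) with the habitat restriction `HW W` threaded through as an idle
binder: the pen's ∃K child after a habitat edit (V2 and/or V14a) is the hypothesis `hUE`, and the re-typed crux is the conclusion.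
[cite: GrossZagier1986, Thm. I.6.3 with V.§2] [cite: GrossLMS1991, §3 (3.5), §4 (4.1)] [cite: McCallumLMS1991, §5 Lemma 5.1] -/
theorem restrictedHabitatSupply_of_grossZagier_of_existsRestrictedKernel (HW : WeierstrassCurve ℚ → Prop)
    (C : WeierstrassCurve ℚ → ℤ → Prop)
    (hGZ : ∀ (W : WeierstrassCurve ℚ) [NeZero (W.conductorNorm ℤ)] (K : Type) [Field K] [NumberField K],
      gross_zagier (W.conductorNorm ℤ) W K)
    (hUE : ∀ (W : WeierstrassCurve ℚ) [W.IsElliptic] [W.IsGloballyMinimal] [NeZero (W.conductorNorm ℤ)],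
      ¬ W.HasCM → W.analyticRank = 0 → (∀ n : ℕ, 0 < n → W.HasSurjectiveModNGaloisRep ((2 : ℤ) ^ n)) →
      Odd W.tamagawaProduct → HW W →
      ∀ (Dt : ModularParametrizationData W (W.conductorNorm ℤ)),
      (∀ z ∈ Dt.L.lattice, ∃ w ∈ periodLattice Dt.f, z = (Dt.c : ℂ) * w) → Odd Dt.c →
      ∃ (K : Type) (_ : Field K) (_ : NumberField K),
        IsImaginaryQuadratic K ∧ Odd (NumberField.discr K) ∧ NumberField.discr K ≠ -3 ∧
        SatisfiesHeegnerHypothesis (W.conductorNorm ℤ) K ∧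
        ¬ IsSquare ((NumberField.discr K : ℚ) * -|W.Δ|) ∧ ¬ IsSquare ((NumberField.discr K : ℚ) * (-(2 * |W.Δ|))) ∧
        C W (NumberField.discr K) ∧
        (∃ (Wd : WeierstrassCurve ℚ) (_ : Wd.IsElliptic) (_ : Wd.IsGloballyMinimal),
          (∃ C' : WeierstrassCurve.VariableChange ℚ, C' • W.quadraticTwist (NumberField.discr K : ℚ) = Wd) ∧
          Wd.analyticRank = 1 ∧ Nat.card (Wd.selmerGroup 2) = 2) ∧
        ∀ (β : ℤ) (ι : K →+* ℂ) (d₁ : KolyvaginHeegnerData Dt β ι 1), ¬ IsOfFinAddOrder d₁.derivedPoint →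
        ∃ (n : ℕ) (d : KolyvaginHeegnerData Dt β ι n) (θ : ℕ → ringClassField K ι n)
          (T : Finset (ringClassField K ι n ≃ₐ[ℚ] ringClassField K ι n)), Squarefree n ∧
          (∀ ℓ ∈ n.primeFactors, Zhang2014.IsKolyvaginPrime (W.conductorNorm ℤ) W K 2 ℓ) ∧
          (∀ ℓ ∈ n.primeFactors, θ ℓ ^ 2 = algebraMap ℚ (ringClassField K ι n) ((-1 : ℚ) ^ (ℓ / 2) * ℓ)) ∧
          (∀ g, g ∈ T ↔ g ∈ ringClassGal ι n ∧ ∀ ℓ ∈ n.primeFactors, g (θ ℓ) = θ ℓ) ∧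
          ¬ ∃ Q : (W.baseChange (ringClassField K ι n)).toAffine.Point, (2 : ℤ) • Q =
            ∑ g ∈ T, pointGalHom W (ringClassField K ι n) g d.y) :
    ∀ (W : WeierstrassCurve ℚ) [W.IsElliptic] [W.IsGloballyMinimal] [NeZero (W.conductorNorm ℤ)],
      ¬ W.HasCM → W.analyticRank = 0 → (∀ n : ℕ, 0 < n → W.HasSurjectiveModNGaloisRep ((2 : ℤ) ^ n)) →
      Odd W.tamagawaProduct → HW W →
      (∃ Dt : ModularParametrizationData W (W.conductorNorm ℤ),
        (∀ z ∈ Dt.L.lattice, ∃ w ∈ periodLattice Dt.f, z = (Dt.c : ℂ) * w) ∧ Odd Dt.c) →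
      ∃ (K : Type) (_ : Field K) (_ : NumberField K),
        IsImaginaryQuadratic K ∧ Odd (NumberField.discr K) ∧ NumberField.discr K ≠ -3 ∧
        SatisfiesHeegnerHypothesis (W.conductorNorm ℤ) K ∧
        ¬ IsSquare ((NumberField.discr K : ℚ) * -|W.Δ|) ∧ ¬ IsSquare ((NumberField.discr K : ℚ) * (-(2 * |W.Δ|))) ∧
        ∃ (Dt : ModularParametrizationData W (W.conductorNorm ℤ)) (β : ℤ) (ι : K →+* ℂ) (d₁ : KolyvaginHeegnerData Dt β ι 1),
          (∀ z ∈ Dt.L.lattice, ∃ w ∈ periodLattice Dt.f, z = (Dt.c : ℂ) * w) ∧ Odd Dt.c ∧ ¬ IsOfFinAddOrder d₁.derivedPoint ∧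
          ∃ M₀ : ℕ, (∃ Q : (W.baseChange (ringClassField K ι 1)).toAffine.Point, ((2 ^ M₀ : ℕ) : ℤ) • Q = d₁.derivedPoint) ∧
            (¬ ∃ Q : (W.baseChange (ringClassField K ι 1)).toAffine.Point, ((2 ^ (M₀ + 1) : ℕ) : ℤ) • Q = d₁.derivedPoint) ∧
            ∃ (n : ℕ) (d : KolyvaginHeegnerData Dt β ι n), Squarefree n ∧
              (∀ ℓ ∈ n.primeFactors, Zhang2014.IsKolyvaginPrime (W.conductorNorm ℤ) W K 2 ℓ) ∧
              (¬ ∃ Q : (W.baseChange (ringClassField K ι n)).toAffine.Point, (2 : ℤ) • Q = d.derivedPoint) ∧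
              ∃ (Wd : WeierstrassCurve ℚ) (_ : Wd.IsElliptic) (_ : Wd.IsGloballyMinimal),
                (∃ C : WeierstrassCurve.VariableChange ℚ, C • W.quadraticTwist (NumberField.discr K : ℚ) = Wd) ∧
                ¬ Wd.HasCM ∧ Wd.analyticRank = 1 ∧ Nat.card (Wd.selmerGroup 2) = 2 := by
  intro W _ _ _ hcm hr0 hρ hT hHW hopt
  obtain ⟨Dt, hoptDt, hc⟩ := hopt
  obtain ⟨K, iF, iN, hIQ, hodd, h3, hHe, hsq1, hsq2, -, ⟨Wd, iE, iM, hWd, hrd, hSel⟩, hcert⟩ :=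
    hUE W hcm hr0 hρ hT hHW Dt hoptDt hc
  obtain ⟨β, hβ⟩ : ∃ β : ℤ, (4 * (W.conductorNorm ℤ : ℕ) : ℤ) ∣ β ^ 2 - NumberField.discr K :=
    Literature.NumberTheory.QuadraticFields.Quadratic.exists_dvd_sq_sub_discr_of_ncard_primesOver hIQ.1 (NeZero.ne _) hHe
  obtain ⟨ι⟩ : Nonempty (K →+* ℂ) := inferInstance
  obtain ⟨d₁⟩ := exists_kolyvaginHeegnerData_one
    (phi_heegnerTau_mem_singularModuliField_holds (W.conductorNorm ℤ) W K) hIQ Dt β ι hβ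
  have hd : (NumberField.discr K : ℚ) ≠ 0 := by exact_mod_cast NumberField.discr_ne_zero K
  haveI := W.isElliptic_quadraticTwist hd
  have hcmd : ¬ Wd.HasCM := twin_not_hasCM W hcm hd Wd hWd
  have hrtw : (W.quadraticTwist (NumberField.discr K : ℚ)).analyticRank = 1 := by
    obtain ⟨C', hC'⟩ := hWd
    rw [← analyticRank_smul (W.quadraticTwist (NumberField.discr K : ℚ)) C', hC']
    exact hrd
  have hy : ¬ IsOfFinAddOrder d₁.derivedPoint :=
    stub_heegnerNonTorsionAtTwo_of_grossZagier hGZ W K hIQ hHe hr0 hrtw Dt β ι d₁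
  obtain ⟨M₀, hdiv, hndiv⟩ := exists_exactTwoDivisibility_of_not_isOfFinAddOrder W hIQ Dt β ι d₁ hy
  obtain ⟨n, d, hn, hKoly, hPn⟩ := exists_derivedPoint_not_two_dvd_of_multiGenusTrace hIQ hodd h3 hHe (hcert β ι d₁ hy)
  exact ⟨K, iF, iN, hIQ, hodd, h3, hHe, hsq1, hsq2, Dt, β, ι, d₁, hoptDt, hc, hy, M₀, hdiv, hndiv, n, d, hn, hKoly, hPn,
    Wd, iE, iM, hWd, hcmd, hrd, hSel⟩

/-- **The ∃K-line after a habitat edit, end to end**: Gross–Zagier ∧ (U∃ restricted by `HW`, `C`) ∧ `KolyvaginExactAtTwo` ∧ (the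
`HW`-restricted residual) ∧ `MinimalTwinBSDTwo` ∧ PRINT ⟹ leaf (§1 ∘ §2). With `HW := fun W ↦ Nat.card (W.selmerGroup 2) ≤ 4` (V14a) and
`C := «DEF = 1»` every hypothesis is BSD+MR-consistent by the seat's finding #2; the open content is U∃ (XL), the LINE-6 children of 22137,
the residual and crux #6. [cite: GrossZagier1986, Thm. I.6.3 with V.§2] [cite: GrossLMS1991, §3 (3.5), §4 (4.1)] -/
theorem nonCMAtTwo_of_restrictedHabitat_of_existsRestrictedKernel (HW : WeierstrassCurve ℚ → Prop)
    (C : WeierstrassCurve ℚ → ℤ → Prop)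
    (hUE : ∀ (W : WeierstrassCurve ℚ) [W.IsElliptic] [W.IsGloballyMinimal] [NeZero (W.conductorNorm ℤ)],
      ¬ W.HasCM → W.analyticRank = 0 → (∀ n : ℕ, 0 < n → W.HasSurjectiveModNGaloisRep ((2 : ℤ) ^ n)) →
      Odd W.tamagawaProduct → HW W →
      ∀ (Dt : ModularParametrizationData W (W.conductorNorm ℤ)),
      (∀ z ∈ Dt.L.lattice, ∃ w ∈ periodLattice Dt.f, z = (Dt.c : ℂ) * w) → Odd Dt.c →
      ∃ (K : Type) (_ : Field K) (_ : NumberField K),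
        IsImaginaryQuadratic K ∧ Odd (NumberField.discr K) ∧ NumberField.discr K ≠ -3 ∧
        SatisfiesHeegnerHypothesis (W.conductorNorm ℤ) K ∧
        ¬ IsSquare ((NumberField.discr K : ℚ) * -|W.Δ|) ∧ ¬ IsSquare ((NumberField.discr K : ℚ) * (-(2 * |W.Δ|))) ∧
        C W (NumberField.discr K) ∧
        (∃ (Wd : WeierstrassCurve ℚ) (_ : Wd.IsElliptic) (_ : Wd.IsGloballyMinimal),
          (∃ C' : WeierstrassCurve.VariableChange ℚ, C' • W.quadraticTwist (NumberField.discr K : ℚ) = Wd) ∧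
          Wd.analyticRank = 1 ∧ Nat.card (Wd.selmerGroup 2) = 2) ∧
        ∀ (β : ℤ) (ι : K →+* ℂ) (d₁ : KolyvaginHeegnerData Dt β ι 1), ¬ IsOfFinAddOrder d₁.derivedPoint →
        ∃ (n : ℕ) (d : KolyvaginHeegnerData Dt β ι n) (θ : ℕ → ringClassField K ι n)
          (T : Finset (ringClassField K ι n ≃ₐ[ℚ] ringClassField K ι n)), Squarefree n ∧
          (∀ ℓ ∈ n.primeFactors, Zhang2014.IsKolyvaginPrime (W.conductorNorm ℤ) W K 2 ℓ) ∧
          (∀ ℓ ∈ n.primeFactors, θ ℓ ^ 2 = algebraMap ℚ (ringClassField K ι n) ((-1 : ℚ) ^ (ℓ / 2) * ℓ)) ∧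
          (∀ g, g ∈ T ↔ g ∈ ringClassGal ι n ∧ ∀ ℓ ∈ n.primeFactors, g (θ ℓ) = θ ℓ) ∧
          ¬ ∃ Q : (W.baseChange (ringClassField K ι n)).toAffine.Point, (2 : ℤ) • Q =
            ∑ g ∈ T, pointGalHom W (ringClassField K ι n) g d.y)
    (hX : KolyvaginExactAtTwo)
    (hR : ∀ (W : WeierstrassCurve ℚ) [W.IsElliptic] [W.IsGloballyMinimal] [NeZero (W.conductorNorm ℤ)],
      ¬ W.HasCM → W.analyticRank ≤ 1 →
      ¬ (W.analyticRank = 0 ∧ (∀ n : ℕ, 0 < n → W.HasSurjectiveModNGaloisRep ((2 : ℤ) ^ n)) ∧ Odd W.tamagawaProduct ∧ HW W ∧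
        ∃ Dt : ModularParametrizationData W (W.conductorNorm ℤ),
          (∀ z ∈ Dt.L.lattice, ∃ w ∈ periodLattice Dt.f, z = (Dt.c : ℂ) * w) ∧ Odd Dt.c) →
      BSDp W 2)
    (hTw : MinimalTwinBSDTwo) (hL : EntireLFunctionRat) (hGZ : GrossZagierAllLevels) (hGZK : MultPublishedInputsAtTwo)
    (hMi : MilneAnyModel) :
    Summit.BirchSwinnertonDyer.BirchSwinnertonDyer.Rank1Residual.NonCMAtTwo :=
  nonCMAtTwo_of_restrictedHabitat HW
    (restrictedHabitatSupply_of_grossZagier_of_existsRestrictedKernel HW C (fun W _ K _ _ ↦ hGZ _ W K) hUE)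
    hX hR hTw hL hGZ hGZK hMi

end Summit.BirchSwinnertonDyer.BirchSwinnertonDyer.Theorems.GenusKoly

end
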